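import Mathlib.Data.ZMod.Basic
import Mathlib.FieldTheory.Finite.Basic
import Mathlib.LinearAlgebra.Matrix.GeneralLinearGroup.Defs
import Mathlib.LinearAlgebra.Matrix.Adjugate
import Mathlib.LinearAlgebra.Matrix.NonsingularInverse
import Mathlib.Logic.Equiv.Fin.Basic
import Literature.Combinatorics.Additive.TripleProductPropertySAT
import HarnessLib

/-!
# The partial multiplication table of `GL₂(𝔽_p)` inside the `p⁴` matrices (for the TPP encoder)

A *kernel-evaluable* model of `GL₂(𝔽_p)` = `Matrix.GeneralLinearGroup (Fin 2) (ZMod p)` for the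
SAT pipeline of `TripleProductPropertySAT.lean` / `Computability/Complexity/LRATImport.lean`:
the `p⁴` matrices `(a b; c d)` over `𝔽_p` are the points of `Fin (p·p·p·p)` (radix-`p` coding via
Mathlib's `finProdFinEquiv`), multiplication / inversion / unit are explicit modular arithmetic
on the digits (inverse by `det^(p-2) · adj`, Fermat), and the mask `valid` is `det ≢ 0`. The
theorem `gl2Table_isPartialTableOf` says this is a partial table of `GL₂(𝔽_p)` along the
injection `gl2Code` (`TripleProductPropertySAT.GroupTable.IsPartialTableOf`), so
`tppCNF (gl2Table p) a b c` is satisfiable iff `GL₂(𝔽_p)` has a TPP triple with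
`|S| ≥ a, |T| ≥ b, |U| ≥ c` (`tppCNF_gl2_satisfiable_iff`), and an imported UNSAT certificate
for it proves nonexistence (`not_exists_tpp_gl2_of_not_satisfiable`). Only `p = 2, 3` give SAT
instances of practical size (`|G| = 6, 48`; `4|G|² + 2` clauses); subgroups are obtained by shrinking the mask (`GroupTable.restrict`,
`GroupTable.IsPartialTableOf.restrict`), e.g. `SL₂(𝔽_p) = ker det` (`sl2Table`,
`sl2Table_isPartialTableOf`, `tppCNF_sl2_satisfiable_iff`); Borel / torus subgroups likewise.

Nothing in this file runs a solver; the defs are pure `Fin`/`ℕ` arithmetic so that `decide` and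
definitional unfolding evaluate them cheaply.

## References

* H. Cohn, C. Umans, FOCS 2003, Def. 2.1 (TPP in a finite group). [cite: CohnUmans2003, Def. 2.1]
* I. Hedtke, S. Murthy, Groups Complex. Cryptol. 4 (2012), Def. 1.2 (the encoded test).
  [cite: HedtkeMurthy2012, Def. 1.2]
-/

namespace Literature.Combinatorics.Additive

open Literature.Computability.Complexity

/-! ### Radix-`p` coding of `2 × 2` matrices -/

/-- The digits `(((a, b), c), d)` of a `2 × 2` matrix `(a b; c d)` over `Fin p`. [folklore] -/
abbrev Quad (p : ℕ) : Type := ((Fin p × Fin p) × Fin p) × Fin p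

/-- Radix-`p` coding of the four digits as a point of `Fin (p·p·p·p)` (Mathlib's
`finProdFinEquiv`, iterated). [folklore] -/
def quadEquiv (p : ℕ) : Quad p ≃ Fin (p * p * p * p) :=
  (Equiv.prodCongr ((Equiv.prodCongr finProdFinEquiv (Equiv.refl (Fin p))).trans finProdFinEquiv)
    (Equiv.refl (Fin p))).trans finProdFinEquiv

section Defs

variable (p : ℕ) [NeZero p]

/-- Reduction of a natural number to a digit. [folklore] -/
def digit (n : ℕ) : Fin p :=
  ⟨n % p, Nat.mod_lt _ (Nat.pos_of_neZero p)⟩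

/-- The product of two coded matrices, digit-wise modular arithmetic:
`(a b; c d)(a' b'; c' d') = (aa'+bc'  ab'+bd'; ca'+dc'  cb'+dd')`. [folklore] -/
def GL2.mulQuad (x y : Quad p) : Quad p :=
  let a := x.1.1.1.val; let b := x.1.1.2.val; let c := x.1.2.val; let d := x.2.val
  let a' := y.1.1.1.val; let b' := y.1.1.2.val; let c' := y.1.2.val; let d' := y.2.val
  (((digit p (a * a' + b * c'), digit p (a * b' + b * d')), digit p (c * a' + d * c')),
    digit p (c * b' + d * d'))

/-- The determinant `ad - bc` of a coded matrix as a digit (computed as `ad + (p² - bc) mod p`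
to stay in `ℕ`). [folklore] -/
def GL2.detNat (x : Quad p) : ℕ :=
  (x.1.1.1.val * x.2.val + (p * p - x.1.1.2.val * x.1.2.val)) % p

/-- The inverse of a coded invertible matrix: `det^(p-2) · (d -b; -c a)` (Fermat inversion;
arbitrary on singular matrices). [folklore] -/
def GL2.invQuad (x : Quad p) : Quad p :=
  let a := x.1.1.1.val; let b := x.1.1.2.val; let c := x.1.2.val; let d := x.2.val
  let di := GL2.detNat p x ^ (p - 2) % p
  (((digit p (di * d), digit p (di * (p - b))), digit p (di * (p - c))), digit p (di * a))

/-- The coded identity matrix. [folklore] -/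
def GL2.oneQuad : Quad p :=
  (((digit p 1, digit p 0), digit p 0), digit p 1)

/-- **The partial table of `GL₂(𝔽_p)`** on `Fin (p·p·p·p)`: all `2 × 2` matrices over `𝔽_p` in
radix-`p` coding, valid = invertible. [folklore] -/
def gl2Table : GroupTable (p * p * p * p) where
  mul i j := quadEquiv p (GL2.mulQuad p ((quadEquiv p).symm i) ((quadEquiv p).symm j))
  inv i := quadEquiv p (GL2.invQuad p ((quadEquiv p).symm i))
  one := quadEquiv p (GL2.oneQuad p)
  valid i := decide (GL2.detNat p ((quadEquiv p).symm i) ≠ 0)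

/-- The matrix of a digit quadruple. [folklore] -/
def GL2.toMat (x : Quad p) : Matrix (Fin 2) (Fin 2) (ZMod p) :=
  !![((x.1.1.1.val : ℕ) : ZMod p), ((x.1.1.2.val : ℕ) : ZMod p);
    ((x.1.2.val : ℕ) : ZMod p), ((x.2.val : ℕ) : ZMod p)]

/-- The digit quadruple of a matrix. [folklore] -/
def GL2.ofMat (M : Matrix (Fin 2) (Fin 2) (ZMod p)) : Quad p :=
  (((⟨(M 0 0).val, ZMod.val_lt _⟩, ⟨(M 0 1).val, ZMod.val_lt _⟩), ⟨(M 1 0).val, ZMod.val_lt _⟩),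
    ⟨(M 1 1).val, ZMod.val_lt _⟩)

/-- **The code of an invertible matrix** in the table `gl2Table p`. [folklore] -/
def gl2Code (x : Matrix.GeneralLinearGroup (Fin 2) (ZMod p)) : Fin (p * p * p * p) :=
  quadEquiv p (GL2.ofMat p (x : Matrix (Fin 2) (Fin 2) (ZMod p)))

end Defs

/-! ### Correctness -/

section Correctness

variable {p : ℕ} [hp : Fact p.Prime]

/-- Casting a digit of `n` gives `n`. [folklore] -/
theorem natCast_digit (n : ℕ) : (((digit p n).val : ℕ) : ZMod p) = n := by
  simp [digit, ZMod.natCast_mod]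

/-- Decoding the coding of a matrix. [folklore] -/
theorem GL2.toMat_ofMat (M : Matrix (Fin 2) (Fin 2) (ZMod p)) : GL2.toMat p (GL2.ofMat p M) = M := by
  ext i j
  fin_cases i <;> fin_cases j <;> simp [GL2.toMat, GL2.ofMat]

/-- Coding the decoding of a quadruple. [folklore] -/
theorem GL2.ofMat_toMat (x : Quad p) : GL2.ofMat p (GL2.toMat p x) = x := by
  obtain ⟨⟨⟨a, b⟩, c⟩, d⟩ := x
  simp only [GL2.ofMat, GL2.toMat, Matrix.of_apply, Matrix.cons_val', Matrix.cons_val_zero,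
    Matrix.cons_val_one, Matrix.cons_val_fin_one, Matrix.empty_val', ZMod.val_natCast,
    Nat.mod_eq_of_lt a.isLt, Nat.mod_eq_of_lt b.isLt, Nat.mod_eq_of_lt c.isLt,
    Nat.mod_eq_of_lt d.isLt]

/-- `ofMat` is injective. [folklore] -/
theorem GL2.ofMat_injective : Function.Injective (GL2.ofMat p) := fun M M' h => by
  rw [← GL2.toMat_ofMat M, h, GL2.toMat_ofMat]

/-- **Coded multiplication is matrix multiplication.** [folklore] -/
theorem GL2.toMat_mulQuad (x y : Quad p) :
    GL2.toMat p (GL2.mulQuad p x y) = GL2.toMat p x * GL2.toMat p y := by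
  ext i j
  fin_cases i <;> fin_cases j <;>
    simp [GL2.toMat, GL2.mulQuad, natCast_digit, Matrix.mul_apply, Fin.sum_univ_two]

/-- The coded identity is the identity matrix. [folklore] -/
theorem GL2.toMat_oneQuad : GL2.toMat p (GL2.oneQuad p) = 1 := by
  ext i j
  fin_cases i <;> fin_cases j <;> simp [GL2.toMat, GL2.oneQuad, natCast_digit]

/-- **The coded determinant is the determinant.** [folklore] -/
theorem GL2.natCast_detNat (x : Quad p) : ((GL2.detNat p x : ℕ) : ZMod p) = (GL2.toMat p x).det := by
  obtain ⟨⟨⟨a, b⟩, c⟩, d⟩ := x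
  have hbc : b.val * c.val ≤ p * p :=
    Nat.mul_le_mul (Nat.le_of_lt b.isLt) (Nat.le_of_lt c.isLt)
  rw [GL2.detNat, ZMod.natCast_mod, Matrix.det_fin_two]
  simp only [GL2.toMat, Matrix.of_apply, Matrix.cons_val', Matrix.cons_val_zero,
    Matrix.cons_val_one, Matrix.cons_val_fin_one, Matrix.empty_val']
  push_cast [Nat.cast_sub hbc]
  rw [ZMod.natCast_self]
  ring

/-- The mask is "determinant nonzero". [folklore] -/
theorem GL2.detNat_ne_zero_iff (x : Quad p) : GL2.detNat p x ≠ 0 ↔ (GL2.toMat p x).det ≠ 0 := by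
  rw [← GL2.natCast_detNat, Ne, Ne, ZMod.natCast_eq_zero_iff]
  have hlt : GL2.detNat p x < p := Nat.mod_lt _ hp.out.pos
  constructor
  · intro h hdvd
    exact h (Nat.eq_zero_of_dvd_of_lt hdvd hlt)
  · intro h h0
    rw [h0] at h
    exact h (dvd_zero p)

/-- Fermat inversion in `𝔽_p`: `a⁻¹ = a^(p-2)` for `a ≠ 0`. [folklore] -/
theorem ZMod.inv_eq_pow_prime_sub_two {a : ZMod p} (ha : a ≠ 0) : a⁻¹ = a ^ (p - 2) := by
  refine inv_eq_of_mul_eq_one_right ?_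
  have h := ZMod.pow_card_sub_one_eq_one ha
  have hp2 : p - 2 + 1 = p - 1 := by have := hp.out.two_le; omega
  rw [← pow_succ', hp2, h]

/-- **Coded inversion is matrix inversion** on invertible matrices. [folklore] -/
theorem GL2.toMat_invQuad (x : Quad p) (hx : (GL2.toMat p x).det ≠ 0) :
    GL2.toMat p (GL2.invQuad p x) = (GL2.toMat p x)⁻¹ := by
  have hdi : (((GL2.detNat p x ^ (p - 2) % p : ℕ) : ℕ) : ZMod p) = ((GL2.toMat p x).det)⁻¹ := by
    rw [ZMod.natCast_mod, Nat.cast_pow, GL2.natCast_detNat, ZMod.inv_eq_pow_prime_sub_two hx]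
  rw [Matrix.inv_def, Ring.inverse_eq_inv, Matrix.adjugate_fin_two]
  obtain ⟨⟨⟨a, b⟩, c⟩, d⟩ := x
  have hb : b.val ≤ p := Nat.le_of_lt b.isLt
  have hc : c.val ≤ p := Nat.le_of_lt c.isLt
  simp only [GL2.toMat, Matrix.of_apply, Matrix.cons_val', Matrix.cons_val_zero,
    Matrix.cons_val_one, Matrix.cons_val_fin_one, Matrix.empty_val'] at hdi ⊢
  ext i j
  fin_cases i <;> fin_cases j <;>
    simp only [GL2.invQuad, Matrix.of_apply, Matrix.cons_val', Matrix.cons_val_zero,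
      Matrix.cons_val_one, Matrix.cons_val_fin_one, Matrix.empty_val', Matrix.smul_apply,
      smul_eq_mul, Fin.zero_eta, Fin.isValue, Fin.mk_one, natCast_digit, Nat.cast_mul, hdi] <;>
    push_cast [Nat.cast_sub hb, Nat.cast_sub hc] <;>
    rw [ZMod.natCast_self] <;>
    ring

/-- Invertible matrices have nonzero determinant (over the field `𝔽_p`). [folklore] -/
theorem GL2.det_coe_ne_zero (x : Matrix.GeneralLinearGroup (Fin 2) (ZMod p)) :
    (x : Matrix (Fin 2) (Fin 2) (ZMod p)).det ≠ 0 := by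
  have := x.isUnit.map Matrix.detMonoidHom
  simpa [isUnit_iff_ne_zero] using this

/-- Quadruples with the same matrix are equal. [folklore] -/
theorem GL2.toMat_injective : Function.Injective (GL2.toMat p) := fun q q' h => by
  rw [← GL2.ofMat_toMat q, h, GL2.ofMat_toMat]

/-- **`gl2Table p` is a partial table of `GL₂(𝔽_p)` along `gl2Code p`.** [folklore] -/
theorem gl2Table_isPartialTableOf (p : ℕ) [Fact p.Prime] :
    (gl2Table p).IsPartialTableOf (Matrix.GeneralLinearGroup (Fin 2) (ZMod p)) (gl2Code p) where
  injective x y h := by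
    apply Units.ext
    exact GL2.ofMat_injective ((quadEquiv p).injective h)
  valid_iff i := by
    simp only [gl2Table, decide_eq_true_eq, GL2.detNat_ne_zero_iff]
    constructor
    · intro h
      refine ⟨Matrix.GeneralLinearGroup.mkOfDetNeZero _ h, ?_⟩
      show quadEquiv p (GL2.ofMat p (GL2.toMat p ((quadEquiv p).symm i))) = i
      rw [GL2.ofMat_toMat, Equiv.apply_symm_apply]
    · rintro ⟨x, rfl⟩
      rw [gl2Code, Equiv.symm_apply_apply, GL2.toMat_ofMat]
      exact GL2.det_coe_ne_zero x
  mul_eq x y := by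
    show quadEquiv p (GL2.mulQuad p ((quadEquiv p).symm (quadEquiv p (GL2.ofMat p ↑x)))
      ((quadEquiv p).symm (quadEquiv p (GL2.ofMat p ↑y)))) = quadEquiv p (GL2.ofMat p ↑(x * y))
    rw [Equiv.symm_apply_apply, Equiv.symm_apply_apply]
    congr 1
    apply GL2.toMat_injective
    rw [GL2.toMat_mulQuad, GL2.toMat_ofMat, GL2.toMat_ofMat, GL2.toMat_ofMat, Units.val_mul]
  inv_eq x := by
    show quadEquiv p (GL2.invQuad p ((quadEquiv p).symm (quadEquiv p (GL2.ofMat p ↑x)))) =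
      quadEquiv p (GL2.ofMat p ↑(x⁻¹))
    rw [Equiv.symm_apply_apply]
    congr 1
    apply GL2.toMat_injective
    rw [GL2.toMat_invQuad _ (by rw [GL2.toMat_ofMat]; exact GL2.det_coe_ne_zero x),
      GL2.toMat_ofMat, GL2.toMat_ofMat, Matrix.coe_units_inv]
  one_eq := by
    show quadEquiv p (GL2.oneQuad p) = quadEquiv p (GL2.ofMat p ↑(1 : Matrix.GeneralLinearGroup (Fin 2) (ZMod p)))
    congr 1
    apply GL2.toMat_injective
    rw [GL2.toMat_oneQuad, GL2.toMat_ofMat, Units.val_one]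

/-- **The TPP encoding of `GL₂(𝔽_p)` is exact**: `tppCNF (gl2Table p) a b c` (`a, b, c ≥ 1`) is
satisfiable iff `GL₂(𝔽_p)` has a TPP triple with `|S| ≥ a`, `|T| ≥ b`, `|U| ≥ c`.
[cite: HedtkeMurthy2012, Def. 1.2] -/
theorem tppCNF_gl2_satisfiable_iff (p : ℕ) [Fact p.Prime] {a b c : ℕ} (ha : 0 < a) (hb : 0 < b)
    (hc : 0 < c) :
    (tppCNF (gl2Table p) a b c).Satisfiable ↔
      ∃ S T U : Finset (Matrix.GeneralLinearGroup (Fin 2) (ZMod p)),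
        TripleProductProperty S T U ∧ a ≤ S.card ∧ b ≤ T.card ∧ c ≤ U.card :=
  tppCNF_satisfiable_iff_of_partial (gl2Table_isPartialTableOf p) ha hb hc

/-- **Nonexistence of TPP triples in `GL₂(𝔽_p)` from an UNSAT certificate** for
`tppCNF (gl2Table p) a b c`. [cite: HedtkeMurthy2012, Def. 1.2] -/
theorem not_exists_tpp_gl2_of_not_satisfiable (p : ℕ) [Fact p.Prime] {a b c : ℕ} (ha : 0 < a)
    (hb : 0 < b) (hc : 0 < c) (h : ¬ (tppCNF (gl2Table p) a b c).Satisfiable) :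
    ¬ ∃ S T U : Finset (Matrix.GeneralLinearGroup (Fin 2) (ZMod p)),
        TripleProductProperty S T U ∧ a ≤ S.card ∧ b ≤ T.card ∧ c ≤ U.card :=
  not_exists_tpp_of_not_satisfiable_of_partial (gl2Table_isPartialTableOf p) ha hb hc h

end Correctness

/-! ### Sub-tables: subgroups by shrinking the mask -/

section Restrict

variable {N : ℕ}

/-- The table with its mask intersected with `mask` (same operations). [folklore] -/
def GroupTable.restrict (T : GroupTable N) (mask : Fin N → Bool) : GroupTable N :=
  { T with valid := fun i => T.valid i && mask i }

/-- **Subgroup tables**: if `T` is a partial table of `G` along `ι` and `mask` cuts out exactly the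
codes of a subgroup `H`, then `T.restrict mask` is a partial table of `H` along `ι ∘ Subtype.val`.
[folklore] -/
theorem GroupTable.IsPartialTableOf.restrict {T : GroupTable N} {G : Type*} [Group G]
    {ι : G → Fin N} (hT : T.IsPartialTableOf G ι) (H : Subgroup G) (mask : Fin N → Bool)
    (hmask : ∀ g : G, mask (ι g) = true ↔ g ∈ H) :
    (T.restrict mask).IsPartialTableOf H (fun h => ι h.1) where
  injective x y h := Subtype.ext (hT.injective h)
  valid_iff i := by
    simp only [GroupTable.restrict, Bool.and_eq_true, hT.valid_iff]
    constructor
    · rintro ⟨⟨g, rfl⟩, hm⟩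
      exact ⟨⟨g, (hmask g).1 hm⟩, rfl⟩
    · rintro ⟨⟨g, hg⟩, rfl⟩
      exact ⟨⟨g, rfl⟩, (hmask g).2 hg⟩
  mul_eq x y := hT.mul_eq x y
  inv_eq x := hT.inv_eq x
  one_eq := hT.one_eq

end Restrict

/-! ### `SL₂(𝔽_p)` as the kernel of the determinant inside `gl2Table p` -/

section SL2

/-- **The partial table of `SL₂(𝔽_p)`** (as the subgroup `ker det` of `GL₂(𝔽_p)`): `gl2Table p`
with the mask shrunk to `det ≡ 1`. [folklore] -/
def sl2Table (p : ℕ) [NeZero p] : GroupTable (p * p * p * p) :=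
  (gl2Table p).restrict fun i => decide (GL2.detNat p ((quadEquiv p).symm i) = 1 % p)

variable {p : ℕ} [hp : Fact p.Prime]

/-- The `SL₂` mask is "determinant one". [folklore] -/
theorem GL2.detNat_eq_one_iff (x : Quad p) :
    GL2.detNat p x = 1 % p ↔ (GL2.toMat p x).det = 1 := by
  rw [← GL2.natCast_detNat, ← Nat.cast_one (R := ZMod p), ZMod.natCast_eq_natCast_iff',
    Nat.mod_eq_of_lt (show GL2.detNat p x < p from Nat.mod_lt _ hp.out.pos)]

/-- **`sl2Table p` is a partial table of `SL₂(𝔽_p) = ker det ≤ GL₂(𝔽_p)` along `gl2Code`.**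
[folklore] -/
theorem sl2Table_isPartialTableOf (p : ℕ) [Fact p.Prime] :
    (sl2Table p).IsPartialTableOf
      (Matrix.GeneralLinearGroup.det (n := Fin 2) (R := ZMod p)).ker
      (fun h => gl2Code p h.1) := by
  refine (gl2Table_isPartialTableOf p).restrict _ _ fun g => ?_
  rw [decide_eq_true_eq, MonoidHom.mem_ker, Units.ext_iff, Matrix.GeneralLinearGroup.val_det_apply,
    Units.val_one, gl2Code, Equiv.symm_apply_apply, GL2.detNat_eq_one_iff, GL2.toMat_ofMat]

/-- **The TPP encoding of `SL₂(𝔽_p)` is exact** (`a, b, c ≥ 1`). [cite: HedtkeMurthy2012, Def. 1.2] -/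
theorem tppCNF_sl2_satisfiable_iff (p : ℕ) [Fact p.Prime] {a b c : ℕ} (ha : 0 < a) (hb : 0 < b)
    (hc : 0 < c) :
    (tppCNF (sl2Table p) a b c).Satisfiable ↔
      ∃ S T U : Finset (Matrix.GeneralLinearGroup.det (n := Fin 2) (R := ZMod p)).ker,
        TripleProductProperty S T U ∧ a ≤ S.card ∧ b ≤ T.card ∧ c ≤ U.card :=
  tppCNF_satisfiable_iff_of_partial (sl2Table_isPartialTableOf p) ha hb hc

end SL2

end Literature.Combinatorics.Additive
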